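import Summits.QuantumFields.YangMills.Theorems.BalabanUVNodesN15KingModelFullPropagator

/-!
# BalabanUVNodes ∕ N15 — THE KING-MODEL RUNG, CURVED EDITION (PART O-c): WHY «OFF-DIAGONAL» — the DIAGONAL of King's full
# `A = 0` fluctuation propagator GROWS geometrically in the number of levels: `G^η_K(x, x) ≥ (L^{d+1}∕L²)^{K−1}·L^{d+1}∕(m₀² + 2(d+1)L² + a)`,
# so NO `K`-uniform bound holds on the diagonal when `d + 1 ≥ 3` (the UV dimension of the fluctuation field) — the off-diagonal
# restriction of parts O-a ∕ O-b (`fullProp_decay_unif`, `fullProp_rate_unif`) is NECESSARY, as a theorem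
# (Track A, DAG node N15 = NE2; FAN-OUT v1.1 §N15 s3 «KING-MODEL RUNG … + the one-line statement of what the curved case adds»)

HONEST FRAMING.  Count-neutral kernel bookkeeping (cell `pub-ymgap`, seat `pub-ymgap-dag-n15-e` g6; `--supports stmt-QuantumFields-19912
--as helper` = K3‴ `SpineGivenEndpointR13`, lineage K3 19676 → K3′ 19908).  TEMPLATE LITERATURE, `A = 0`: C. King's scalar U(1)-Higgs MODEL
on finite tori ([King1986] (2.13)–(2.17) p. 653, (2.20) p. 654, (3.30)–(3.31) p. 659 (degree of a graph: an internal line end counts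
`1 − d∕2`, i.e. the propagator has UV dimension `d − 2` in King's `d`), §4 p. 675 (4.42)–(4.44)); a TIGHTNESS statement about the tree's objects,
not a printed proposition; NOT Bałaban's covariant objects; NOT a node discharge; nothing continuum ∕ ℝ⁴ ∕ OS ∕ mass-gap ∕ Clay.
0 `sorry`, 0 `def`, standard axioms.

THE POINT.  Parts O-a ∕ O-b bound the full propagator `G(K, M, m²) = constrainedProp (L^K) M (aK a L K) ((L^K)²) m² = (L^K)^{d+1}·A₀⁻¹` and
its η-difference only for points whose unit blocks are `≥ D₀` apart, and their headers say why.  THIS FILE proves the why: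
* §1 `dotProduct_inv_mulVec_nonneg` (the inverse of a coercive matrix is a nonnegative form: `f·S⁻¹f = (S⁻¹f)·S(S⁻¹f) ≥ 0`),
  `triple_eq_dotProduct_mulVec`, **`ksSlice_diag_nonneg`** — every slice `G^ε_{(j)} = ℋ_jC^{(j)}ℋ_jᵀ` of (2.17) is NONNEGATIVE on the
  diagonal (`C^{(j)} = (Δ^{(j)} + aL⁻²Q^*Q)⁻¹` is the inverse of a coercive matrix: `CovarianceSplitting.effLaplacian_coercive_of_nonneg` +
  `blockProj_form_nonneg`);
* §2 **`fullProp_diag_peel_ge`** — the peel of part O-a read on the diagonal: `G(K+1, M_e, m²)(flatten x, flatten x) ≥ (L^{d+1}∕L²)·G(K, fine L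
  M_e, m²∕L²)(x, x)` (the top slice only ADDS on the diagonal);
* §3 `fineOp_diag_le`, **`fineOp_inv_diag_ge`** — for the SPD matrix `A₀ = c(−Δ) + m² + aQ^*Q`: `A₀(x, x) ≤ m² + 2d′c + a` and `A₀⁻¹(x, x) ≥
  1∕A₀(x, x)` (the quadratic `0 ≤ (w − te_x)·A₀(w − te_x)` at `w = A₀⁻¹e_x`, `t = 1∕A₀(x,x)`), hence `G(1, M, m²)(x, x) ≥ L^{d+1}∕(m² + 2(d+1)L² + a)`;
* §4 **`fullProp_diag_ge`** — for EVERY `K ≥ 1`, cube `M_μ = 2L^e`, `0 < m² ≤ m₀²` and fine point `x`: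
  `G^η_K(x, x) ≥ (L^{d+1}∕L²)^{K−1}·L^{d+1}∕(m₀² + 2(d+1)L² + a)` (induction on `K`: §2 + §3, the mass `m²∕L^{2j} ≤ m₀²` at every level);
  **`fullProp_diag_unbounded`** — for `d ≥ 2` (dimension `d + 1 ≥ 3`, `L^{d+1}∕L² ≥ L > 1`) no constant bounds `G^η_K(x, x)` for all `K`:
  the diagonal is exactly where the `K`-uniform statements of parts O-a∕O-b must fail.  (For `d + 1 = 2` the factor is `1` and this
  argument gives no growth — consistent with the logarithmic UV behaviour there; not claimed.)
* §5 **`fullProp_abs_le_levels`** — the matching GLOBAL UPPER BOUND, all pairs: `|G^η_K(x, y)| ≤ C·Σ_{i<K}(L^{d+1}∕L²)^i` uniformly in the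
  cube, the mass `0 < m² ≤ m₀²` and the points (the peel + part M `ksSlice_decay_unif` with `e^{−δD} ≤ 1` + [Ba 4] (1.10) at the bottom);
  with §4 the diagonal is of EXACT order `(L^{d−1})^K` for `d ≥ 2`, and `O(K) = O(log_L η⁻¹)` for `d + 1 = 2`.
HONEST SCOPE.  (i) `A = 0`, periodic b.c., `L ≥ 2`, `m² > 0`; (ii) lattice units of level `K` (as parts F–O); (iii) a lower bound on the
tree's objects, nothing printed is contradicted (King never asserts a uniform diagonal bound; (3.63) is slice-by-slice with `(L^jη)^{2−d}`);
(iv) not Bałaban's `G_k(U)`; not a discharge.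
Locators: [King1986] C. King, CMP **102** (1986) 649–677: (2.13)–(2.17) p. 653, (2.20) p. 654, (3.30)–(3.31) p. 659, (4.33) p. 674, (4.42)–(4.44) p. 675.
-/

noncomputable section

namespace Summit.QuantumFields.YangMills.BalabanUVNodes.N15KingModelRung.Curved

open Real Finset Matrix
open Literature.MathematicalPhysics.QuantumFieldTheory.Balaban1983to89 (Params QGQInverse.Coercive QGQInverse.isUnit_of_coercive)
open Literature.MathematicalPhysics.QuantumFieldTheory.Balaban1983to89.B5Prop11Plancherel (Tor fine unitVec)
open Literature.MathematicalPhysics.QuantumFieldTheory.King1986 (aK aK_pos aK_le)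
open Literature.MathematicalPhysics.QuantumFieldTheory.King1986.Torus (constrainedProp flatten fineOp lapF blockProj oneStepCov
  effLaplacian effLaplacian_coercive_of_nonneg blockProj_form_nonneg fineOp_coercive fineOp_transpose fineOp_isUnit blockOf tdistT
  tdistT_nonneg constrainedProp_decay_blocks_unif)

variable {d : ℕ} (L : ℕ) [NeZero L]

/-! ## §1 Slices are nonnegative on the diagonal -/

/-- **The inverse of a coercive matrix is a nonnegative form**: `0 ≤ f·(S⁻¹f)` (`= w·(Sw)` with `w = S⁻¹f`, `≥ γ|w|² ≥ 0`; no symmetry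
needed). [folklore] -/
theorem dotProduct_inv_mulVec_nonneg {n : Type*} [Fintype n] [DecidableEq n] {S : Matrix n n ℝ} {γ : ℝ} (hγ : 0 < γ)
    (h : QGQInverse.Coercive S γ) (f : n → ℝ) : 0 ≤ f ⬝ᵥ (S⁻¹ *ᵥ f) := by
  set w := S⁻¹ *ᵥ f with hw
  have hU : IsUnit S.det := (Matrix.isUnit_iff_isUnit_det S).mp (QGQInverse.isUnit_of_coercive hγ h)
  have hSw : S *ᵥ w = f := by rw [hw, Matrix.mulVec_mulVec, Matrix.mul_nonsing_inv S hU, Matrix.one_mulVec]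
  have h1 : f ⬝ᵥ w = w ⬝ᵥ (S *ᵥ w) := by rw [← hSw, dotProduct_comm]
  have h2 := h w
  have h3 : 0 ≤ w ⬝ᵥ w := Literature.LinearAlgebra.Matrix.dotProduct_self_nonneg_real w
  rw [h1]
  nlinarith

/-- Part F₀'s triple contraction is the bilinear form of the middle matrix: `triple f C g = f·(Cg)`. [folklore] -/
theorem triple_eq_dotProduct_mulVec {U : Type*} [Fintype U] (f : U → ℝ) (C : Matrix U U ℝ) (g : U → ℝ) :
    triple f C g = f ⬝ᵥ (C *ᵥ g) := by
  simp only [triple, dotProduct, Matrix.mulVec, Finset.sum_mul, Finset.mul_sum]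
  rw [Finset.sum_comm]
  exact Finset.sum_congr rfl fun z _ => Finset.sum_congr rfl fun w _ => by ring

/-- **Every slice of (2.17) is nonnegative on the diagonal**: `0 ≤ ksSlice m² i (x, x) = ℋ_j(x,·)·C^{(j)}ℋ_j(x,·)`, `C^{(j)} = (Δ^{(j)} + aL⁻²Q^*Q)⁻¹`
the inverse of a coercive matrix (`Δ^{(j)} ≥ (a_j⁻¹ + m⁻²)⁻¹`, `Q^*Q ≥ 0`). [cite: King1986, (2.16)–(2.17) p.653, (4.33) p.674] -/
theorem ksSlice_diag_nonneg (hL : 2 ≤ L) {a m2 : ℝ} (ha : 0 < a) (hm : 0 < m2) (i : KSliceIdx d)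
    (x : Tor (fine (L ^ i.j) (ksU L i))) : 0 ≤ ksSlice L a m2 i x x := by
  have hLr : (1 : ℝ) < L := by exact_mod_cast (show 1 < L by omega)
  have ha₁ : 0 < aK a L i.j := aK_pos ha hLr i.one_le_j
  -- coercivity of `Δ^{(j)} + aL⁻²Q^*Q`
  have hγ : 0 < ((aK a L i.j)⁻¹ + m2⁻¹)⁻¹ := by positivity
  have hco : QGQInverse.Coercive
      (effLaplacian (L ^ i.j) (fine L (ksM L i)) (aK a L i.j) (((L ^ i.j : ℕ) : ℝ) ^ 2) m2
        + (a * ((L : ℝ) ^ 2)⁻¹) • blockProj L (ksM L i)) ((aK a L i.j)⁻¹ + m2⁻¹)⁻¹ := by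
    intro φ
    have h1 := effLaplacian_coercive_of_nonneg (L ^ i.j) (fine L (ksM L i)) ha₁ (sq_nonneg (((L ^ i.j : ℕ) : ℝ))) hm φ
    have h2 : 0 ≤ φ ⬝ᵥ (blockProj L (ksM L i) *ᵥ φ) := blockProj_form_nonneg L (ksM L i) φ
    rw [Matrix.add_mulVec, dotProduct_add, Matrix.smul_mulVec, dotProduct_smul, smul_eq_mul]
    have h3 : 0 ≤ a * ((L : ℝ) ^ 2)⁻¹ * (φ ⬝ᵥ (blockProj L (ksM L i) *ᵥ φ)) := mul_nonneg (by positivity) h2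
    linarith
  rw [ksSlice, triple_eq_dotProduct_mulVec, ksC_eq_oneStepCov, oneStepCov]
  exact dotProduct_inv_mulVec_nonneg hγ hco _

/-! ## §2 The peel on the diagonal -/

/-- **The top slice only adds on the diagonal**: `(L^{d+1}∕L²)·G(K, fine L M_e, m²∕L²)(x, x) ≤ G(K+1, M_e, m²)(flatten x, flatten x)`
(part O-a `fullProp_peel'` + §1). [cite: King1986, (2.17) p.653, (2.20) p.654] -/
theorem fullProp_diag_peel_ge (hL : 2 ≤ L) {a msq : ℝ} (ha : 0 < a) (hm : 0 < msq) (i : KSliceIdx d)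
    (x : Tor (fine (L ^ i.j) (ksU L i))) :
    (L : ℝ) ^ (d + 1) / (L : ℝ) ^ 2 *
        constrainedProp (L ^ i.j) (ksU L i) (aK a L i.j) (((L ^ i.j : ℕ) : ℝ) ^ 2) (msq / (L : ℝ) ^ 2) x x
      ≤ constrainedProp (L ^ i.j * L) (ksM L i) (aK a L (i.j + 1)) (((L ^ i.j * L : ℕ) : ℝ) ^ 2) msq
          (flatten (L ^ i.j) L (ksM L i) x) (flatten (L ^ i.j) L (ksM L i) x) := by
  have hΛ : 0 ≤ (L : ℝ) ^ (d + 1) / (L : ℝ) ^ 2 := by positivity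
  have hS := ksSlice_diag_nonneg L hL ha (m2 := msq / (L : ℝ) ^ 2) (div_pos hm (by positivity)) i x
  rw [fullProp_peel' L hL ha hm i x x, mul_add]
  nlinarith [mul_nonneg hΛ hS]

/-! ## §3 The one-level propagator on the diagonal -/

/-- **The diagonal entry of `A₀ = c(−Δ) + m² + aQ^*Q` is at most `m² + 2d′c + a`** (`(−Δ)(x,x) = 2d′c` minus nonnegative wrap-around
terms, `(Q^*Q)(x, x) = N^{−d′} ≤ 1`). [cite: King1986, (4.1)–(4.5) p.670] -/
theorem fineOp_diag_le {d' : ℕ} (N : ℕ) [NeZero N] (M : Fin d' → ℕ) [∀ μ, NeZero (M μ)] {a c : ℝ} (m2 : ℝ)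
    (ha : 0 ≤ a) (hc : 0 ≤ c) (x : Tor (fine N M)) :
    fineOp N M a c m2 x x ≤ m2 + 2 * d' * c + a := by
  have hN : (1 : ℝ) ≤ (N : ℝ) ^ d' := one_le_pow₀ (by exact_mod_cast Nat.one_le_iff_ne_zero.mpr (NeZero.ne N))
  have hP : blockProj N M x x = ((N : ℝ) ^ d')⁻¹ := by rw [blockProj, if_pos rfl]
  have hP1 : blockProj N M x x ≤ 1 := by rw [hP]; exact inv_le_one_of_one_le₀ hN
  have hsum : 0 ≤ ∑ μ : Fin d', ((if x = x + unitVec (fine N M) μ then (1 : ℝ) else 0)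
      + (if x = x - unitVec (fine N M) μ then (1 : ℝ) else 0)) :=
    Finset.sum_nonneg fun μ _ => add_nonneg (by split_ifs <;> norm_num) (by split_ifs <;> norm_num)
  have hlap : lapF (fine N M) c m2 x x ≤ m2 + 2 * d' * c := by
    rw [lapF, if_pos rfl, mul_one]
    nlinarith [mul_nonneg hc hsum]
  rw [fineOp, Matrix.add_apply, Matrix.smul_apply, smul_eq_mul]
  nlinarith [mul_le_mul_of_nonneg_left hP1 ha]

/-- **The diagonal of the inverse of the SPD matrix `A₀` dominates the reciprocal of its diagonal**: `A₀⁻¹(x, x) ≥ 1∕(m² + 2d′c + a)`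
(`0 ≤ (w − te_x)·A₀(w − te_x)` with `w = A₀⁻¹e_x`, `t = 1∕A₀(x,x)`, symmetry `A₀ᵀ = A₀` and `A₀ ≥ m² > 0`). [cite: King1986, (4.5) p.670, (4.44) p.675] -/
theorem fineOp_inv_diag_ge {d' : ℕ} (N : ℕ) [NeZero N] (M : Fin d' → ℕ) [∀ μ, NeZero (M μ)] {a c m2 : ℝ}
    (ha : 0 ≤ a) (hc : 0 ≤ c) (hm : 0 < m2) (x : Tor (fine N M)) :
    1 / (m2 + 2 * d' * c + a) ≤ (fineOp N M a c m2)⁻¹ x x := by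
  set S := fineOp N M a c m2 with hSdef
  set e : Tor (fine N M) → ℝ := Pi.single x 1 with hedef
  set w : Tor (fine N M) → ℝ := S⁻¹ *ᵥ e with hwdef
  have hU : IsUnit S.det := (Matrix.isUnit_iff_isUnit_det S).mp (fineOp_isUnit N M ha hc hm)
  have hSw : S *ᵥ w = e := by rw [hwdef, Matrix.mulVec_mulVec, Matrix.mul_nonsing_inv S hU, Matrix.one_mulVec]
  have hsymm : Sᵀ = S := fineOp_transpose N M a c m2
  -- the scalars: `q = w·e = S⁻¹(x,x)`, `s = e·Se = S(x,x)`
  have hq : w ⬝ᵥ e = S⁻¹ x x := by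
    rw [hedef, dotProduct_single_one, hwdef, Matrix.mulVec_single_one, Matrix.col_apply]
  have hs : e ⬝ᵥ (S *ᵥ e) = S x x := by
    rw [hedef, Matrix.mulVec_single_one, single_one_dotProduct, Matrix.col_apply]
  have hs0 : 0 < S x x := by
    have h1 := fineOp_coercive N M m2 ha hc e
    rw [← hSdef, hs] at h1
    have h2 : e ⬝ᵥ e = 1 := by rw [hedef, dotProduct_single_one, Pi.single_eq_same]
    rw [h2, mul_one] at h1
    exact lt_of_lt_of_le hm h1
  have hsle : S x x ≤ m2 + 2 * d' * c + a := fineOp_diag_le N M m2 ha hc x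
  -- the cross terms: `e·(Sw) = e·e = 1` and `w·(Se) = (Sw)·e = 1` (symmetry)
  have hee : e ⬝ᵥ e = 1 := by rw [hedef, dotProduct_single_one, Pi.single_eq_same]
  have hcross1 : e ⬝ᵥ (S *ᵥ w) = 1 := by rw [hSw, hee]
  have hcross2 : w ⬝ᵥ (S *ᵥ e) = 1 := by
    rw [Matrix.dotProduct_mulVec, ← Matrix.mulVec_transpose, hsymm, hSw, hee]
  -- `q ≥ 0`-type control: the quadratic form at `w − t e`, `t = 1∕s`
  set t : ℝ := 1 / S x x with htdef
  have hquad : 0 ≤ (w - t • e) ⬝ᵥ (S *ᵥ (w - t • e)) := by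
    have h1 := fineOp_coercive N M m2 ha hc (w - t • e)
    rw [← hSdef] at h1
    have h2 : 0 ≤ (w - t • e) ⬝ᵥ (w - t • e) := Literature.LinearAlgebra.Matrix.dotProduct_self_nonneg_real _
    nlinarith
  have hexpand : (w - t • e) ⬝ᵥ (S *ᵥ (w - t • e))
      = w ⬝ᵥ (S *ᵥ w) - t * (w ⬝ᵥ (S *ᵥ e)) - t * (e ⬝ᵥ (S *ᵥ w)) + t * t * (e ⬝ᵥ (S *ᵥ e)) := by
    simp only [Matrix.mulVec_sub, Matrix.mulVec_smul, dotProduct_sub, sub_dotProduct, dotProduct_smul, smul_dotProduct,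
      smul_eq_mul]
    ring
  have hqq : w ⬝ᵥ (S *ᵥ w) = S⁻¹ x x := by rw [hSw, hq]
  rw [hexpand, hcross1, hcross2, hs, hqq] at hquad
  -- `0 ≤ q − 2t + t²s = q − 1∕s`
  have ht : t * S x x = 1 := by rw [htdef]; field_simp
  have hq_ge : 1 / S x x ≤ S⁻¹ x x := by
    have : t * t * S x x = t := by rw [mul_assoc, ht, mul_one]
    rw [this] at hquad
    rw [← htdef]
    linarith
  calc 1 / (m2 + 2 * d' * c + a) ≤ 1 / S x x := one_div_le_one_div_of_le hs0 hsle
    _ ≤ S⁻¹ x x := hq_ge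

/-- **The one-level propagator on the diagonal**: `G(1-type)(x, x) = N^{d′}·A₀⁻¹(x, x) ≥ N^{d′}∕(m² + 2d′c + a)`. [cite: King1986, (2.13) p.653, (4.44) p.675] -/
theorem constrainedProp_diag_ge {d' : ℕ} (N : ℕ) [NeZero N] (M : Fin d' → ℕ) [∀ μ, NeZero (M μ)] {a c m2 : ℝ}
    (ha : 0 ≤ a) (hc : 0 ≤ c) (hm : 0 < m2) (x : Tor (fine N M)) :
    (N : ℝ) ^ d' / (m2 + 2 * d' * c + a) ≤ constrainedProp N M a c m2 x x := by
  have hNd : 0 ≤ (N : ℝ) ^ d' := by positivity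
  rw [constrainedProp, Matrix.smul_apply, smul_eq_mul, div_eq_mul_one_div]
  exact mul_le_mul_of_nonneg_left (fineOp_inv_diag_ge N M ha hc hm x) hNd

/-! ## §4 The diagonal grows geometrically in the number of levels -/

/-- **THE DIAGONAL OF KING'S FULL `A = 0` FLUCTUATION PROPAGATOR GROWS GEOMETRICALLY IN `K`**: for `L ≥ 2`, `a > 0`, any cap `m₀²`, EVERY `K ≥ 1`
(any spelling `N = L^K`), cube `M_μ = 2L^e`, mass `0 < m² ≤ m₀²` and fine point `x`:
`G^η_K(x, x) ≥ (L^{d+1}∕L²)^{K−1}·L^{d+1}∕(m₀² + 2(d+1)L² + a)` (induction on `K`: the peel only adds on the diagonal, §2; the bottom level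
§3 with `a_1 ≤ a`, `c = L²`, `m² ≤ m₀²`).  In lattice units of level `K` this is the UV growth `∼ (L^K)^{d−1}` of the covariance of a
field of dimension `(d−1)∕2` in `d + 1` dimensions. [cite: King1986, (2.13)–(2.17) p.653, (2.20) p.654, (3.30)–(3.31) p.659, (4.44) p.675] -/
theorem fullProp_diag_ge (hL : 2 ≤ L) {a : ℝ} (ha : 0 < a) (m0sq : ℝ) :
    ∀ (K : ℕ), 1 ≤ K → ∀ (N : ℕ) [NeZero N], N = L ^ K →
      ∀ (e : ℕ) (M : Fin (d + 1) → ℕ) [∀ μ, NeZero (M μ)], (∀ μ, M μ = 2 * L ^ e) →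
      ∀ (msq : ℝ), 0 < msq → msq ≤ m0sq → ∀ x : Tor (fine N M),
        ((L : ℝ) ^ (d + 1) / (L : ℝ) ^ 2) ^ (K - 1) * ((L : ℝ) ^ (d + 1) / (m0sq + 2 * ((d + 1 : ℕ) : ℝ) * (L : ℝ) ^ 2 + a))
          ≤ constrainedProp N M (aK a L K) (((N : ℕ) : ℝ) ^ 2) msq x x := by
  have hL1 : 1 < L := by omega
  have hLr : (1 : ℝ) < L := by exact_mod_cast hL1
  have hL0 : (0 : ℝ) < L := by positivity
  intro K hK
  induction K, hK using Nat.le_induction with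
  | base =>
    intro N _ hN e M _ hM msq hmsq hcap x
    subst hN
    have ha1 : 0 ≤ aK a L 1 := (aK_pos ha hLr le_rfl).le
    have h := constrainedProp_diag_ge (L ^ 1) M ha1 (sq_nonneg (((L ^ 1 : ℕ) : ℝ))) hmsq x
    have hden0 : 0 < msq + 2 * ((d + 1 : ℕ) : ℝ) * (((L ^ 1 : ℕ) : ℝ)) ^ 2 + aK a L 1 := by positivity
    have hden : msq + 2 * ((d + 1 : ℕ) : ℝ) * (((L ^ 1 : ℕ) : ℝ)) ^ 2 + aK a L 1
        ≤ m0sq + 2 * ((d + 1 : ℕ) : ℝ) * (L : ℝ) ^ 2 + a := by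
      have h1 : (((L ^ 1 : ℕ) : ℝ)) ^ 2 = (L : ℝ) ^ 2 := by push_cast; ring
      rw [h1]
      linarith [aK_le ha hLr (le_refl 1)]
    have hnum : (((L ^ 1 : ℕ) : ℝ)) ^ (d + 1) = (L : ℝ) ^ (d + 1) := by push_cast; ring
    rw [pow_zero, one_mul]
    calc (L : ℝ) ^ (d + 1) / (m0sq + 2 * ((d + 1 : ℕ) : ℝ) * (L : ℝ) ^ 2 + a)
        ≤ (((L ^ 1 : ℕ) : ℝ)) ^ (d + 1) / (msq + 2 * ((d + 1 : ℕ) : ℝ) * (((L ^ 1 : ℕ) : ℝ)) ^ 2 + aK a L 1) := by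
          rw [hnum]; exact div_le_div_of_nonneg_left (by positivity) hden0 hden
      _ ≤ constrainedProp (L ^ 1) M (aK a L 1) (((L ^ 1 : ℕ) : ℝ) ^ 2) msq x x := h
  | succ K hK IH =>
    intro N _ hN e M _ hM msq hmsq hcap x'
    subst hN
    obtain rfl : M = fun _ => 2 * L ^ e := funext hM
    set i : KSliceIdx d := ⟨e, K, hK, 1, le_rfl, 0, Nat.zero_le e, 1, le_rfl⟩ with hidef
    obtain ⟨x, rfl⟩ := (flatten (L ^ K) L (ksM L i)).surjective x'
    have hL2 : (0 : ℝ) < (L : ℝ) ^ 2 := by positivity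
    have hm2 : 0 < msq / (L : ℝ) ^ 2 := div_pos hmsq hL2
    have hm2cap : msq / (L : ℝ) ^ 2 ≤ m0sq := by
      have h1 : (1 : ℝ) ≤ (L : ℝ) ^ 2 := one_le_pow₀ hLr.le
      exact (div_le_self hmsq.le h1).trans hcap
    have hM' : ∀ μ, ksU L i μ = 2 * L ^ (e + 1) := fun μ => by
      show L * (2 * L ^ e) = 2 * L ^ (e + 1)
      ring
    have hIH := IH (L ^ K) rfl (e + 1) (ksU L i) hM' (msq / (L : ℝ) ^ 2) hm2 hm2cap x
    have hpeel := fullProp_diag_peel_ge L hL ha hmsq i x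
    have hΛ : 0 ≤ (L : ℝ) ^ (d + 1) / (L : ℝ) ^ 2 := by positivity
    have hKs : K + 1 - 1 = (K - 1) + 1 := by omega
    calc ((L : ℝ) ^ (d + 1) / (L : ℝ) ^ 2) ^ (K + 1 - 1) * ((L : ℝ) ^ (d + 1) / (m0sq + 2 * ((d + 1 : ℕ) : ℝ) * (L : ℝ) ^ 2 + a))
        = (L : ℝ) ^ (d + 1) / (L : ℝ) ^ 2 *
            (((L : ℝ) ^ (d + 1) / (L : ℝ) ^ 2) ^ (K - 1) * ((L : ℝ) ^ (d + 1) / (m0sq + 2 * ((d + 1 : ℕ) : ℝ) * (L : ℝ) ^ 2 + a))) := by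
          rw [hKs, pow_succ]; ring
      _ ≤ (L : ℝ) ^ (d + 1) / (L : ℝ) ^ 2 *
            constrainedProp (L ^ K) (ksU L i) (aK a L K) (((L ^ K : ℕ) : ℝ) ^ 2) (msq / (L : ℝ) ^ 2) x x :=
          mul_le_mul_of_nonneg_left hIH hΛ
      _ ≤ constrainedProp (L ^ K * L) (ksM L i) (aK a L (K + 1)) (((L ^ K * L : ℕ) : ℝ) ^ 2) msq
            (flatten (L ^ K) L (ksM L i) x) (flatten (L ^ K) L (ksM L i) x) := hpeel

/-- **NO `K`-UNIFORM BOUND ON THE DIAGONAL for `d ≥ 2`** (dimension `d + 1 ≥ 3`; then `L^{d+1}∕L² ≥ L ≥ 2`): for every `C` there are a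
number of levels `K` — indeed every large one — such that on EVERY cube and at EVERY fine point `G^η_K(x, x) > C` for every mass
`0 < m² ≤ m₀²`.  This is exactly why parts O-a ∕ O-b state their `K`-uniform bounds off the diagonal. [cite: King1986, (2.17) p.653, (3.30)–(3.31) p.659] -/
theorem fullProp_diag_unbounded (hd : 2 ≤ d) (hL : 2 ≤ L) {a : ℝ} (ha : 0 < a) {m0sq : ℝ} (hm0 : 0 ≤ m0sq) (C : ℝ) :
    ∃ K : ℕ, 1 ≤ K ∧ ∀ (e : ℕ) (msq : ℝ), 0 < msq → msq ≤ m0sq →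
      ∀ x : Tor (fine (L ^ K) (fun _ : Fin (d + 1) => 2 * L ^ e)),
        C < constrainedProp (L ^ K) (fun _ : Fin (d + 1) => 2 * L ^ e) (aK a L K) (((L ^ K : ℕ) : ℝ) ^ 2) msq x x := by
  have hL1 : (1 : ℝ) < L := by exact_mod_cast (show 1 < L by omega)
  have hL0 : (0 : ℝ) < L := by positivity
  set Λ : ℝ := (L : ℝ) ^ (d + 1) / (L : ℝ) ^ 2 with hΛdef
  set B : ℝ := (L : ℝ) ^ (d + 1) / (m0sq + 2 * ((d + 1 : ℕ) : ℝ) * (L : ℝ) ^ 2 + a) with hBdef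
  have hB : 0 < B := by positivity
  -- `Λ = L^{d−1} ≥ L > 1`
  have hΛ1 : 1 < Λ := by
    rw [hΛdef, lt_div_iff₀ (by positivity), one_mul]
    calc (L : ℝ) ^ 2 < (L : ℝ) ^ 3 := pow_lt_pow_right₀ hL1 (by norm_num)
      _ ≤ (L : ℝ) ^ (d + 1) := pow_le_pow_right₀ hL1.le (by omega)
  -- a power of `Λ` beyond `C∕B`
  obtain ⟨n, hn⟩ := pow_unbounded_of_one_lt (C / B) hΛ1
  refine ⟨n + 1, by omega, fun e msq hmsq hcap x => ?_⟩
  have h := fullProp_diag_ge (d := d) L hL ha m0sq (n + 1) (by omega) (L ^ (n + 1)) rfl e (fun _ => 2 * L ^ e) (fun _ => rfl)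
    msq hmsq hcap x
  have h1 : C < Λ ^ n * B := by rw [← div_lt_iff₀ hB]; exact hn
  have h2 : n + 1 - 1 = n := by omega
  rw [h2] at h
  exact h1.trans_le h

/-! ## §5 The matching global upper bound: `|G^η_K| ≤ C·Σ_{i<K}(L^{d+1}∕L²)^i` -/

/-- **GLOBAL UPPER BOUND OF THE FULL PROPAGATOR, ALL PAIRS, in the number of levels**: for odd `L ≥ 3`, `a > 0`, `m₀² ≥ 0` there is `C > 0` with
`|G^η_K(x, y)| ≤ C·Σ_{i<K}(L^{d+1}∕L²)^i` for EVERY `K ≥ 1` (any spelling `N = L^K`), cube `M_μ = 2L^e`, mass `0 < m² ≤ m₀²` and ALL fine `x, y`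
(induction on `K`: the peel + the slice bound `|ksSlice| ≤ C_s` of part M + the one-level bound of [Ba 4] (1.10) with a point source).  With §4: the
diagonal is of exact order `(L^{d−1})^K` for `d ≥ 2`; for `d + 1 = 2` the sum is `K = log_L η⁻¹`.
[cite: King1986, (2.13)–(2.17) p.653, (2.20) p.654, (3.30)–(3.31) p.659, (4.44) p.675; Balaban1983RegularityDecay, Theorem (1.10) p.573] -/
theorem fullProp_abs_le_levels (hLodd : Odd L) (hL : 2 ≤ L) {a : ℝ} (ha : 0 < a) {m0sq : ℝ} (hm0 : 0 ≤ m0sq) :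
    ∃ C : ℝ, 0 < C ∧ ∀ (K : ℕ), 1 ≤ K → ∀ (N : ℕ) [NeZero N], N = L ^ K →
      ∀ (e : ℕ) (M : Fin (d + 1) → ℕ) [∀ μ, NeZero (M μ)], (∀ μ, M μ = 2 * L ^ e) →
      ∀ (msq : ℝ), 0 < msq → msq ≤ m0sq → ∀ x y : Tor (fine N M),
        |constrainedProp N M (aK a L K) (((N : ℕ) : ℝ) ^ 2) msq x y|
          ≤ C * ∑ i ∈ Finset.range K, ((L : ℝ) ^ (d + 1) / (L : ℝ) ^ 2) ^ i := by
  have hL1 : 1 < L := by omega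
  have hLr : (1 : ℝ) < L := by exact_mod_cast hL1
  have hL0 : (0 : ℝ) < L := by positivity
  obtain ⟨δb, cb, hδb, hcb, Hb⟩ := constrainedProp_decay_blocks_unif (d + 1) L (by omega) ⟨hLodd, hL1⟩ ha hm0
  obtain ⟨Cs, κ, hCs, hκ, Hs⟩ := ksSlice_decay_unif (d := d) L hLodd hL ha hm0
  set Λ : ℝ := (L : ℝ) ^ (d + 1) / (L : ℝ) ^ 2 with hΛdef
  have hΛ : 0 < Λ := by positivity
  set C : ℝ := max ((L : ℝ) ^ (d + 1) * cb) (Λ * Cs) with hCdef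
  have hC : 0 < C := lt_max_of_lt_right (mul_pos hΛ hCs)
  have hCb : (L : ℝ) ^ (d + 1) * cb ≤ C := le_max_left _ _
  have hCs' : Λ * Cs ≤ C := le_max_right _ _
  refine ⟨C, hC, ?_⟩
  intro K hK
  induction K, hK using Nat.le_induction with
  | base =>
    intro N _ hN e M _ hM msq hmsq hcap x y
    subst hN
    set P : Params := ⟨d + 1, L, e, 1, by omega, ⟨hLodd, hL1⟩⟩ with hPdef
    have hMK : ∀ μ, M μ = P.sitesPerDir P.K := fun μ => by
      rw [hM μ]
      simp [hPdef, Params.sitesPerDir]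
    have h := Hb P rfl rfl le_rfl msq hmsq.le hcap M hMK (L ^ 1) rfl x y
    have hcast : (((L ^ 1 : ℕ) : ℝ)) ^ P.d * cb = (L : ℝ) ^ (d + 1) * cb := by
      simp [hPdef]
    rw [hcast] at h
    have hexp : Real.exp (-(δb * tdistT M (blockOf (L ^ 1) M x) (blockOf (L ^ 1) M y))) ≤ 1 :=
      Real.exp_le_one_iff.mpr (by nlinarith [tdistT_nonneg M (blockOf (L ^ 1) M x) (blockOf (L ^ 1) M y)])
    rw [Finset.sum_range_one, pow_zero, mul_one]
    calc |constrainedProp (L ^ 1) M (aK a L 1) (((L ^ 1 : ℕ) : ℝ) ^ 2) msq x y|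
        ≤ (L : ℝ) ^ (d + 1) * cb * Real.exp (-(δb * tdistT M (blockOf (L ^ 1) M x) (blockOf (L ^ 1) M y))) := h
      _ ≤ (L : ℝ) ^ (d + 1) * cb * 1 := mul_le_mul_of_nonneg_left hexp (by positivity)
      _ ≤ C := by rw [mul_one]; exact hCb
  | succ K hK IH =>
    intro N _ hN e M _ hM msq hmsq hcap x' y'
    subst hN
    obtain rfl : M = fun _ => 2 * L ^ e := funext hM
    set i : KSliceIdx d := ⟨e, K, hK, 1, le_rfl, 0, Nat.zero_le e, 1, le_rfl⟩ with hidef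
    obtain ⟨x, rfl⟩ := (flatten (L ^ K) L (ksM L i)).surjective x'
    obtain ⟨y, rfl⟩ := (flatten (L ^ K) L (ksM L i)).surjective y'
    have hL2 : (0 : ℝ) < (L : ℝ) ^ 2 := by positivity
    have hm2 : 0 < msq / (L : ℝ) ^ 2 := div_pos hmsq hL2
    have hm2cap : msq / (L : ℝ) ^ 2 ≤ m0sq := by
      have h1 : (1 : ℝ) ≤ (L : ℝ) ^ 2 := one_le_pow₀ hLr.le
      exact (div_le_self hmsq.le h1).trans hcap
    have hM' : ∀ μ, ksU L i μ = 2 * L ^ (e + 1) := fun μ => by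
      show L * (2 * L ^ e) = 2 * L ^ (e + 1)
      ring
    have hIH := IH (L ^ K) rfl (e + 1) (ksU L i) hM' (msq / (L : ℝ) ^ 2) hm2 hm2cap x y
    have hS0 := (Hs (msq / (L : ℝ) ^ 2) hm2 hm2cap i).1 x y
    have hS : |ksSlice L a (msq / (L : ℝ) ^ 2) i x y| ≤ Cs :=
      hS0.trans (by
        have hexp : Real.exp (-(κ * tdistT (ksU L i) (blockOf (L ^ i.j) (ksU L i) x) (blockOf (L ^ i.j) (ksU L i) y))) ≤ 1 :=
          Real.exp_le_one_iff.mpr (by nlinarith [tdistT_nonneg (ksU L i) (blockOf (L ^ i.j) (ksU L i) x) (blockOf (L ^ i.j) (ksU L i) y)])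
        nlinarith)
    have hpeel := fullProp_peel_abs_le L hL ha hmsq i x y
    have hsum0 : 0 ≤ ∑ i ∈ Finset.range K, Λ ^ i := Finset.sum_nonneg fun j _ => pow_nonneg hΛ.le j
    calc |constrainedProp (L ^ K * L) (ksM L i) (aK a L (K + 1)) (((L ^ K * L : ℕ) : ℝ) ^ 2) msq
            (flatten (L ^ K) L (ksM L i) x) (flatten (L ^ K) L (ksM L i) y)|
        ≤ Λ * (|constrainedProp (L ^ K) (ksU L i) (aK a L K) (((L ^ K : ℕ) : ℝ) ^ 2) (msq / (L : ℝ) ^ 2) x y|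
            + |ksSlice L a (msq / (L : ℝ) ^ 2) i x y|) := hpeel
      _ ≤ Λ * (C * ∑ i ∈ Finset.range K, Λ ^ i + Cs) := mul_le_mul_of_nonneg_left (add_le_add hIH hS) hΛ.le
      _ = C * ∑ i ∈ Finset.range K, Λ ^ (i + 1) + Λ * Cs := by
          rw [mul_add, Finset.mul_sum, Finset.mul_sum, Finset.mul_sum]
          congr 1
          exact Finset.sum_congr rfl fun j _ => by rw [pow_succ]; ring
      _ ≤ C * ∑ i ∈ Finset.range K, Λ ^ (i + 1) + C * Λ ^ 0 := by rw [pow_zero, mul_one]; linarith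
      _ = C * ∑ i ∈ Finset.range (K + 1), Λ ^ i := by rw [Finset.sum_range_succ', mul_add]

end Summit.QuantumFields.YangMills.BalabanUVNodes.N15KingModelRung.Curved
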